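import Mathlib.Analysis.Fourier.LpSpace
import Mathlib.MeasureTheory.Measure.Haar.NormedSpace
import Literature.Analysis.FunctionSpaces.PlancherelL1L2
import Literature.Analysis.Fourier.L2FourierReflection
import HarnessLib

/-!
# The `L²` Fourier transform and dilations `u ↦ u(c·)` on the line

Analysis/Fourier support file (theorem-only, no definitions, no named facts). For `u ∈ L²(ℝ; F)`
(`F` a complex Hilbert space) and a real `c ≠ 0`, the dilate `x ↦ u(cx)` is again in `L²`
(`memLp_comp_mul_left`; its class is written `(memLp_comp_mul_left (Lp.memLp u) hc).toLp _` below,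
"`δᶜu`"), with `‖δᶜu‖ = |c|^{−1/2}‖u‖` (`norm_toLp_comp_mul_left`), and Mathlib's `L²` Fourier
transform (`MeasureTheory.Lp.fourierTransformₗᵢ`) satisfies

* `fourier_toLp_comp_mul_left`: `𝓕(δᶜu) = |c|⁻¹ δ^{1/c}(𝓕u)` (Grafakos, Prop. 2.2.11 (8):
  `(δᵗf)^ = t⁻ⁿ δ^{1/t} f̂`, stated there for Schwartz `f` and `t > 0`; extended to `L²` by density
  as in §2.2.4, here `n = 1` and any `c ≠ 0`);
* `fourier_comp_mul_left_ae_eq`: the operator-free form `𝓕v(ξ) = |c|⁻¹ 𝓕u(ξ/c)` a.e. whenever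
  `v = u(c·)` a.e.;
* the function-level identity `fourierIntegral_comp_mul_left` (change of variables).

Proof of the `L²` statement: both sides are continuous in `u` (`continuous_toLp_comp_mul_left`) and
agree on (the dense image of) Schwartz functions, where the transforms are Fourier integrals
(`SchwartzMap.toLp_fourier_eq`, the tree's `PlancherelL1L2.fourier_toLp_ae_eq_fourierIntegral` for
`φ(c·) ∈ L¹ ∩ L²`). Used in `NumberTheory/LFunctions/SuzukiWeilModelSpace.lean` (Suzuki's
normalisation `(𝖥ψ)(u) = (𝓕⁻ψ)(u/2π)` of the Fourier transform; dilation invariance of the Hardy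
space `H² ⊂ L²(ℝ)`).

## Mathlib search
`MeasureTheory.Lp.fourierTransformₗᵢ`, `SchwartzMap.toLp_fourier_eq`, `SchwartzMap.denseRange_toLpCLM`,
`Real.map_volume_mul_left`, `MeasureTheory.Measure.integral_comp_mul_left`,
`MeasureTheory.eLpNorm_comp_measurePreserving`, `MeasureTheory.eLpNorm_smul_measure_of_ne_zero`,
`Integrable.comp_mul_left'`; the tree's `LpMultiplierDilation.fourier_comp_smul` is the function-level
identity in `ℝᵈ` (not imported: multiplier cone); no `L²`-operator statement exists.

## References
* L. Grafakos, *Classical Fourier Analysis*, 3rd ed., GTM 249, Springer 2014: Prop. 2.2.11 (8)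
  (PDF p. 126 of the held copy), §2.2.4 (PDF pp. 129–130). [Grafakos2014]
-/

noncomputable section

open MeasureTheory SchwartzMap Real FourierTransform Filter
open scoped ENNReal

namespace Literature.Analysis.Fourier

/-- `𝓕(f(c·))(ξ) = |c|⁻¹ 𝓕f(ξ/c)` for `c ≠ 0` (function level; change of variables).
[cite: Grafakos2014, Prop. 2.2.11 (8), PDF p. 126] -/
theorem fourierIntegral_comp_mul_left {E : Type*} [NormedAddCommGroup E] [NormedSpace ℂ E]
    (f : ℝ → E) {c : ℝ} (hc : c ≠ 0) (ξ : ℝ) :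
    𝓕 (fun x : ℝ => f (c * x)) ξ = |c|⁻¹ • 𝓕 f (c⁻¹ * ξ) := by
  rw [Real.fourier_real_eq, Real.fourier_real_eq]
  have h : (fun v : ℝ => (𝐞 (-(v * ξ)) : Circle) • f (c * v))
      = fun v => (fun w : ℝ => (𝐞 (-(w * (c⁻¹ * ξ))) : Circle) • f w) (c * v) := by
    funext v
    simp only
    rw [show c * v * (c⁻¹ * ξ) = v * ξ by field_simp]
  rw [h, Measure.integral_comp_mul_left (fun w : ℝ => (𝐞 (-(w * (c⁻¹ * ξ))) : Circle) • f w) c,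
    abs_inv]

variable {F : Type*} [NormedAddCommGroup F]

/-- The dilation `x ↦ cx` (`c ≠ 0`) maps Lebesgue measure to `|c|⁻¹ ·` Lebesgue measure.
[cite: Grafakos2014, §2.2.2 eq. (2.2.13) (the dilation δᵃf(x) = f(ax)), PDF p. 126] -/
theorem measurePreserving_mul_left {c : ℝ} (hc : c ≠ 0) :
    MeasurePreserving (fun x : ℝ => c * x) volume (ENNReal.ofReal |c⁻¹| • volume) :=
  ⟨measurable_const_mul c, Real.map_volume_mul_left hc⟩

/-- The dilation `x ↦ cx` (`c ≠ 0`) is quasi-measure-preserving for Lebesgue measure (null sets are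
preserved). Private copy of the tree's `FluidPDE.quasiMeasurePreserving_mul_left`
(`ForwardDSSExistenceLocalProofs.lean`, not imported: Navier–Stokes dependency cone); public users
take `(measurePreserving_mul_left hc).quasiMeasurePreserving.mono_right Measure.smul_absolutelyContinuous`.
[folklore] -/
private theorem quasiMeasurePreserving_mul_left {c : ℝ} (hc : c ≠ 0) :
    Measure.QuasiMeasurePreserving (fun x : ℝ => c * x) volume volume :=
  (measurePreserving_mul_left hc).quasiMeasurePreserving.mono_right
    Measure.smul_absolutelyContinuous

/-- `Lᵖ` is stable under dilations: `f ∈ Lᵖ ⟹ f(c·) ∈ Lᵖ` (`c ≠ 0`).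
[cite: Grafakos2014, Prop. 2.2.11 (8) and §2.2.2 eq. (2.2.13), PDF p. 126] -/
theorem memLp_comp_mul_left {p : ℝ≥0∞} {f : ℝ → F} (hf : MemLp f p volume) {c : ℝ} (hc : c ≠ 0) :
    MemLp (fun x : ℝ => f (c * x)) p volume :=
  (hf.smul_measure ENNReal.ofReal_ne_top).comp_measurePreserving (measurePreserving_mul_left hc)

/-- `‖f(c·)‖_{Lᵖ} = |c|^{−1/p} ‖f‖_{Lᵖ}` (Haar measure of a dilate). [cite: Grafakos2014, Prop. 2.2.11 (8), PDF p. 126] -/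
theorem eLpNorm_comp_mul_left {p : ℝ≥0∞} {f : ℝ → F} (hf : AEStronglyMeasurable f volume) {c : ℝ}
    (hc : c ≠ 0) :
    eLpNorm (fun x : ℝ => f (c * x)) p volume =
      ENNReal.ofReal |c⁻¹| ^ (1 / p).toReal * eLpNorm f p volume := by
  have h := eLpNorm_comp_measurePreserving (p := p)
    (hf.smul_measure (ENNReal.ofReal |c⁻¹|)) (measurePreserving_mul_left hc)
  rw [Function.comp_def] at h
  rw [h, eLpNorm_smul_measure_of_ne_zero, smul_eq_mul]
  simpa only [ne_eq, ENNReal.ofReal_eq_zero, not_le, abs_pos] using inv_ne_zero hc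

/-- The `L²` class of the dilate: `δᶜu = u(c·)` almost everywhere. [cite: Grafakos2014, §2.2.2 eq. (2.2.13), PDF p. 126] -/
theorem coeFn_toLp_comp_mul_left (u : Lp F 2 (volume : Measure ℝ)) {c : ℝ} (hc : c ≠ 0) :
    (((memLp_comp_mul_left (Lp.memLp u) hc).toLp _ : Lp F 2 (volume : Measure ℝ)) : ℝ → F)
      =ᵐ[volume] fun x : ℝ => (u : ℝ → F) (c * x) :=
  MemLp.coeFn_toLp _

/-- `‖δᶜu‖_{L²} = |c|^{−1/2} ‖u‖_{L²}`. [cite: Grafakos2014, Prop. 2.2.11 (8), PDF p. 126] -/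
theorem norm_toLp_comp_mul_left (u : Lp F 2 (volume : Measure ℝ)) {c : ℝ} (hc : c ≠ 0) :
    ‖((memLp_comp_mul_left (Lp.memLp u) hc).toLp _ : Lp F 2 (volume : Measure ℝ))‖ =
      |c|⁻¹ ^ (1 / 2 : ℝ) * ‖u‖ := by
  rw [Lp.norm_toLp, Lp.norm_def, eLpNorm_comp_mul_left (Lp.aestronglyMeasurable u) hc,
    ENNReal.toReal_mul, ← ENNReal.toReal_rpow, ENNReal.toReal_ofReal (abs_nonneg _), abs_inv]
  norm_num

/-- Dilation is additive on `L²`: `δᶜ(u + w) = δᶜu + δᶜw`. [cite: Grafakos2014, §2.2.2 eq. (2.2.13), PDF p. 126] -/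
theorem toLp_comp_mul_left_add (u w : Lp F 2 (volume : Measure ℝ)) {c : ℝ} (hc : c ≠ 0) :
    ((memLp_comp_mul_left (Lp.memLp (u + w)) hc).toLp _ : Lp F 2 (volume : Measure ℝ)) =
      (memLp_comp_mul_left (Lp.memLp u) hc).toLp _ + (memLp_comp_mul_left (Lp.memLp w) hc).toLp _ := by
  apply Lp.ext
  filter_upwards [coeFn_toLp_comp_mul_left (u + w) hc, coeFn_toLp_comp_mul_left u hc,
    coeFn_toLp_comp_mul_left w hc, (quasiMeasurePreserving_mul_left hc).ae (Lp.coeFn_add u w),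
    Lp.coeFn_add ((memLp_comp_mul_left (Lp.memLp u) hc).toLp _ : Lp F 2 (volume : Measure ℝ))
      ((memLp_comp_mul_left (Lp.memLp w) hc).toLp _)] with x h1 h2 h3 h4 h5
  rw [h1, h5, Pi.add_apply, h2, h3, h4, Pi.add_apply]

/-- Dilation is continuous on `L²` (it is additive with `‖δᶜu‖ = |c|^{−1/2}‖u‖`).
[cite: Grafakos2014, Prop. 2.2.11 (8), PDF p. 126] -/
theorem continuous_toLp_comp_mul_left {c : ℝ} (hc : c ≠ 0) :
    Continuous fun u : Lp F 2 (volume : Measure ℝ) =>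
      ((memLp_comp_mul_left (Lp.memLp u) hc).toLp _ : Lp F 2 (volume : Measure ℝ)) := by
  let T : Lp F 2 (volume : Measure ℝ) →+ Lp F 2 (volume : Measure ℝ) :=
    { toFun := fun u => (memLp_comp_mul_left (Lp.memLp u) hc).toLp _
      map_zero' := by
        have h := toLp_comp_mul_left_add (0 : Lp F 2 (volume : Measure ℝ)) 0 hc
        rw [add_zero] at h
        exact left_eq_add.mp h
      map_add' := fun u w => toLp_comp_mul_left_add u w hc }
  exact AddMonoidHomClass.continuous_of_bound T (|c|⁻¹ ^ (1 / 2 : ℝ))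
    fun u => (norm_toLp_comp_mul_left u hc).le

variable [InnerProductSpace ℂ F]

/-- The dilate of (the class of) a Schwartz function is the class of `x ↦ φ(cx)`.
[cite: Grafakos2014, §2.2.2 eq. (2.2.13), PDF p. 126] -/
theorem toLp_comp_mul_left_schwartz (φ : 𝓢(ℝ, F)) {c : ℝ} (hc : c ≠ 0) :
    ((memLp_comp_mul_left (Lp.memLp (φ.toLp 2 (volume : Measure ℝ))) hc).toLp _ :
        Lp F 2 (volume : Measure ℝ)) =
      (memLp_comp_mul_left (φ.memLp 2 (volume : Measure ℝ)) hc).toLp (fun x : ℝ => φ (c * x)) := by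
  refine MemLp.toLp_congr _ _ ?_
  filter_upwards [(quasiMeasurePreserving_mul_left hc).ae (φ.coeFn_toLp 2 (volume : Measure ℝ))]
    with x hx
  exact hx

variable [CompleteSpace F]

/-- **`𝓕(δᶜu) = |c|⁻¹ δ^{1/c}(𝓕u)` on `L²(ℝ; F)`** (`c ≠ 0`): the `L²` Fourier transform of the
dilate `u(c·)` is `|c|⁻¹ (𝓕u)(·/c)` (on Schwartz functions both sides are the Fourier integral
identity `fourierIntegral_comp_mul_left`; both sides are continuous and Schwartz functions are
dense). [cite: Grafakos2014, Prop. 2.2.11 (8), PDF p. 126; §2.2.4, PDF pp. 129–130] -/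
theorem fourier_toLp_comp_mul_left (u : Lp F 2 (volume : Measure ℝ)) {c : ℝ} (hc : c ≠ 0) :
    (𝓕 ((memLp_comp_mul_left (Lp.memLp u) hc).toLp _ : Lp F 2 (volume : Measure ℝ)) :
        Lp F 2 (volume : Measure ℝ)) =
      |c|⁻¹ • ((memLp_comp_mul_left (Lp.memLp (𝓕 u : Lp F 2 (volume : Measure ℝ)))
        (inv_ne_zero hc)).toLp _ : Lp F 2 (volume : Measure ℝ)) := by
  have hc' : c⁻¹ ≠ 0 := inv_ne_zero hc
  have hd := SchwartzMap.denseRange_toLpCLM (E := ℝ) (F := F) (p := 2) (μ := (volume : Measure ℝ))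
    ENNReal.ofNat_ne_top
  refine congrFun (hd.equalizer
    ((continuous_fourier (E := Lp F 2 (volume : Measure ℝ))).comp (continuous_toLp_comp_mul_left hc))
    (((continuous_toLp_comp_mul_left hc').comp
      (continuous_fourier (E := Lp F 2 (volume : Measure ℝ)))).const_smul |c|⁻¹) ?_) u
  funext φ
  simp only [Pi.smul_apply, Function.comp_apply, SchwartzMap.toLpCLM_apply]
  have hint : Integrable (fun x : ℝ => φ (c * x)) (volume : Measure ℝ) :=
    φ.integrable.comp_mul_left' hc
  have hmem : MemLp (fun x : ℝ => φ (c * x)) 2 (volume : Measure ℝ) :=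
    memLp_comp_mul_left (φ.memLp 2 (volume : Measure ℝ)) hc
  rw [toLp_comp_mul_left_schwartz φ hc, SchwartzMap.toLp_fourier_eq]
  apply Lp.ext
  filter_upwards [Literature.Analysis.FunctionSpaces.fourier_toLp_ae_eq_fourierIntegral hint hmem,
    Lp.coeFn_smul |c|⁻¹ ((memLp_comp_mul_left (Lp.memLp ((𝓕 φ).toLp 2 (volume : Measure ℝ)))
      hc').toLp _ : Lp F 2 (volume : Measure ℝ)),
    coeFn_toLp_comp_mul_left ((𝓕 φ).toLp 2 (volume : Measure ℝ)) hc',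
    (quasiMeasurePreserving_mul_left hc').ae ((𝓕 φ).coeFn_toLp 2 (volume : Measure ℝ))]
    with ξ h1 h2 h3 h4
  rw [h1, h2, Pi.smul_apply, h3, h4, SchwartzMap.fourier_coe]
  exact fourierIntegral_comp_mul_left φ hc ξ

/-- **`𝓕v(ξ) = |c|⁻¹ 𝓕u(ξ/c)` a.e. whenever `v = u(c·)` a.e.** (`c ≠ 0`; operator-free form of
`fourier_toLp_comp_mul_left`). [cite: Grafakos2014, Prop. 2.2.11 (8), PDF p. 126; §2.2.4, PDF pp. 129–130] -/
theorem fourier_comp_mul_left_ae_eq {u v : Lp F 2 (volume : Measure ℝ)} {c : ℝ} (hc : c ≠ 0)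
    (h : (v : ℝ → F) =ᵐ[volume] fun x : ℝ => (u : ℝ → F) (c * x)) :
    ((𝓕 v : Lp F 2 (volume : Measure ℝ)) : ℝ → F) =ᵐ[volume]
      fun ξ : ℝ => |c|⁻¹ • ((𝓕 u : Lp F 2 (volume : Measure ℝ)) : ℝ → F) (c⁻¹ * ξ) := by
  have hv : v = (memLp_comp_mul_left (Lp.memLp u) hc).toLp _ :=
    Lp.ext (h.trans (coeFn_toLp_comp_mul_left u hc).symm)
  rw [hv, fourier_toLp_comp_mul_left u hc]
  filter_upwards [Lp.coeFn_smul |c|⁻¹ ((memLp_comp_mul_left (Lp.memLp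
      (𝓕 u : Lp F 2 (volume : Measure ℝ))) (inv_ne_zero hc)).toLp _ : Lp F 2 (volume : Measure ℝ)),
    coeFn_toLp_comp_mul_left (𝓕 u : Lp F 2 (volume : Measure ℝ)) (inv_ne_zero hc)] with ξ h1 h2
  rw [h1, Pi.smul_apply, h2]

/-- **`𝓕⁻v(ξ) = |c|⁻¹ 𝓕⁻u(ξ/c)` a.e. whenever `v = u(c·)` a.e.** (the same for the inverse
transform, via `𝓕⁻ w = 𝓕 (w(−·))`, the tree's `fourierInv_eq_fourier_compNeg`).
[cite: Grafakos2014, Prop. 2.2.11 (8), PDF p. 126; §2.2.4, PDF p. 130] -/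
theorem fourierInv_comp_mul_left_ae_eq {u v : Lp F 2 (volume : Measure ℝ)} {c : ℝ} (hc : c ≠ 0)
    (h : (v : ℝ → F) =ᵐ[volume] fun x : ℝ => (u : ℝ → F) (c * x)) :
    ((𝓕⁻ v : Lp F 2 (volume : Measure ℝ)) : ℝ → F) =ᵐ[volume]
      fun ξ : ℝ => |c|⁻¹ • ((𝓕⁻ u : Lp F 2 (volume : Measure ℝ)) : ℝ → F) (c⁻¹ * ξ) := by
  have hneg := Measure.measurePreserving_neg (volume : Measure ℝ)
  have hq : Measure.QuasiMeasurePreserving (fun x : ℝ => -x) volume volume :=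
    hneg.quasiMeasurePreserving
  -- the reflections satisfy `v(−·) = u(−c·) = (u(−·))(c·)` a.e.
  have hR : ((Lp.compMeasurePreserving (fun x : ℝ => -x) hneg v : Lp F 2 (volume : Measure ℝ)) :
        ℝ → F) =ᵐ[volume]
      fun x : ℝ => ((Lp.compMeasurePreserving (fun x : ℝ => -x) hneg u :
        Lp F 2 (volume : Measure ℝ)) : ℝ → F) (c * x) := by
    filter_upwards [Lp.coeFn_compMeasurePreserving v hneg, hq.ae h,
      (quasiMeasurePreserving_mul_left hc).ae (Lp.coeFn_compMeasurePreserving u hneg)]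
      with x h1 h2 h3
    simp only [Function.comp_apply] at h1 h2 h3
    rw [h1, h2, h3, mul_neg]
  rw [fourierInv_eq_fourier_compNeg v, fourierInv_eq_fourier_compNeg u]
  exact fourier_comp_mul_left_ae_eq hc hR

end Literature.Analysis.Fourier

end
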